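import Summits.Schanuel.Schanuel.Theses.RigidCore
import Literature.ModelTheory.ExponentialFields.KMOPointwiseDefinableProofs

/-!
# Sketch — crux-ideate stmt-Schanuel-0969 (MinimalCounterexampleInAcl), ideator 2, round 1

First lemmas of the two idea cards, stated over existing declarations (no proofs; `def … : Prop`).
Namespace mirrors the crux directory `Summits/Schanuel/Schanuel/Cruxes/MinimalCounterexampleInAcl`.
-/

noncomputable section

open Complex

namespace Summit.Schanuel.Schanuel.Cruxes.MinimalCounterexampleInAcl.Sketch

open Literature.ModelTheory.ExponentialFields (Language.expRing)
open Literature.NumberTheory.Transcendental (IsDefinedOver zariskiDim IsIrreducibleClosed SchanuelRank)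

/-- Shorthand: `a ∈ acl^{ℂ_exp}(∅)` — `a` lies in a finite `∅`-definable subset of `(ℂ,+,·,exp)`
(the conclusion of the crux, verbatim). -/
def InAcl (a : ℂ) : Prop :=
  ∃ s : Set ℂ, s.Finite ∧ Set.Definable₁ (∅ : Set ℂ) Language.expRing s ∧ a ∈ s

/-! ## Card `torsor-self-selection` -/

/-- FIRST LEMMA (card torsor-self-selection), abstract selection principle, provable now:
an `∅`-definable set `S ⊆ ℂ` lying in finitely many cosets of the kernel `2πiℤ`
(i.e. `exp '' S` finite) in which every non-zero integer gap `2πik` is realised by only finitely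
many pairs is contained in `acl(∅)`: either a kernel class of `S` is a singleton (a finite definable
set), or its closest pairs form a finite non-empty `∅`-definable subset `F`, and every element of
the class is `f + 2πi·(numeral)` for some `f ∈ F` (`ℤ` and `{±2πi}` are `∅`-definable:
`kmo_definable_isInt`, `kmo_definable_isKernelGenerator`). -/
def TorsorSelfSelection : Prop :=
  ∀ S : Set ℂ, Set.Definable₁ (∅ : Set ℂ) Language.expRing S →
    (cexp '' S).Finite →
    (∀ k : ℤ, k ≠ 0 → Set.Finite {a ∈ S | a + 2 * ↑Real.pi * I * (k : ℂ) ∈ S}) →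
    ∀ a ∈ S, InAcl a

/-- FIRST LEMMA (card torsor-self-selection), torsor rank 2 = the Baker class, provable now from
Hermite–Lindemann alone: a `ℚ`-linearly independent pair of logarithms of algebraic numbers that is
algebraically DEPENDENT over `ℚ` (an SC(2)-counterexample with both exponentials algebraic) has both
coordinates in `acl^{ℂ_exp}(∅)` — with NO finiteness statement and NO Baker: closest pairs of the
branch set `{(j,k) : R(x₁ + 2πij, x₂ + 2πik) = 0}` are finite because a translation symmetry of the
conjugate plane curves forces `R` linear, and then `e^{κ}` algebraic with `κ ≠ 0` algebraic
contradicts Hermite–Lindemann. -/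
def LogPairCounterexampleInAcl : Prop :=
  ∀ x : Fin 2 → ℂ, LinearIndependent ℚ x →
    (∀ i, IsAlgebraic ℚ (cexp (x i))) →
    Algebra.trdeg ℚ ↥(IntermediateField.adjoin ℚ (Set.range x ∪ Set.range (cexp ∘ x))) <
      (2 : Cardinal) →
    ∀ i, InAcl (x i)

/-- MAIN CLAIM of card torsor-self-selection (torsor rank ≥ 1 at n = 2): an SC(2)-counterexample
whose locus is MULTIPLICATIVELY DEGENERATE — some non-trivial monomial `e^{m·x}` is algebraic, i.e.
the `y`-projection of the locus component lies in a coset of a proper subtorus — has both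
coordinates in `acl^{ℂ_exp}(∅)`, whether or not the solution set on its locus is finite. -/
def MultDegenerateCounterexampleInAcl : Prop :=
  ∀ x : Fin 2 → ℂ, LinearIndependent ℚ x →
    Algebra.trdeg ℚ ↥(IntermediateField.adjoin ℚ (Set.range x ∪ Set.range (cexp ∘ x))) <
      (2 : Cardinal) →
    (∃ m : Fin 2 → ℤ, m ≠ 0 ∧ IsAlgebraic ℚ (cexp (∑ i, (m i : ℂ) * x i))) →
    ∀ i, InAcl (x i)

/-! ## Card `isolation-is-free` -/

/-- FIRST LEMMA (card isolation-is-free), provable now with the tree's definability API: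
`ℚ`-linear independence of an `n`-tuple is `∅`-definable in `ℂ_exp`
(`ℚ = {w/z : z, w ∈ ker exp, z ≠ 0}`, KMO §2.2). -/
def LinearIndependentDefinable : Prop :=
  ∀ n : ℕ, Set.Definable (∅ : Set ℂ) Language.expRing {v : Fin n → ℂ | LinearIndependent ℚ v}

/-- Sparsity at rank `n` (the `n`-dimensional form of the route's `SparsityTwo`): a `ℚ`-variety
`W ⊆ ℂⁿ × ℂⁿ` of dimension `< n` carries finitely many graph points with `ℚ`-linearly independent
abscissa. -/
def SparsityAt (n : ℕ) : Prop :=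
  ∀ W : Set (Fin n ⊕ Fin n → ℂ), IsDefinedOver (⊥ : Subfield ℂ) W → zariskiDim ℂ W < n →
    Set.Finite {x : Fin n → ℂ | LinearIndependent ℚ x ∧ Sum.elim x (cexp ∘ x) ∈ W}

/-- CLAIM (card isolation-is-free): definable isolation is free — sparsity implies the crux
VERBATIM, because the set of independent solutions on the (fixed, `ℚ`-defined) locus of the
counterexample is itself a finite `∅`-definable set. -/
def IsolationIsFree : Prop :=
  (∀ n, SparsityAt n) → Summit.Schanuel.Schanuel.Theses.RigidCore.MinimalCounterexampleInAcl

/-- `W ⊆ ℂ² × ℂ²` is multiplicatively free: no non-trivial monomial in the `y`-coordinates is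
constant on `W`. -/
def IsMultFree (W : Set (Fin 2 ⊕ Fin 2 → ℂ)) : Prop :=
  ∀ m : Fin 2 → ℤ, m ≠ 0 → ∀ c : ℂ, ¬ ∀ p ∈ W, (∏ i, p (Sum.inr i) ^ m i) = c

/-- The residual of (S*) at `n = 2` after the two cards: SparsityTwo restricted to geometrically
irreducible, multiplicatively FREE `ℚ̄`-curves (on these a solution has no algebraic monomial value
at all, by Hermite–Lindemann; this is exactly the locus class of the atoms (α), (β) of card
pell-orbit-analyticity-shapiro and the 'generic' case of Zilber's uniform Schanuel conjecture). -/
def FreeSparsityTwo : Prop :=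
  ∀ W : Set (Fin 2 ⊕ Fin 2 → ℂ), IsDefinedOver (algebraicClosure ℚ ℂ).toSubfield W →
    IsIrreducibleClosed ℂ W → zariskiDim ℂ W < 2 → IsMultFree W →
    Set.Finite {x : Fin 2 → ℂ | LinearIndependent ℚ x ∧ Sum.elim x (cexp ∘ x) ∈ W}

/-- CLAIM (cards together): (S*) at the first open rank `n = 2` follows from FreeSparsityTwo and
the torsor self-selection theorem. -/
def MinimalCounterexampleInAclTwo : Prop :=
  ∀ x : Fin 2 → ℂ, LinearIndependent ℚ x →
    Algebra.trdeg ℚ ↥(IntermediateField.adjoin ℚ (Set.range x ∪ Set.range (cexp ∘ x))) <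
      (2 : Cardinal) →
    (∀ r < 2, SchanuelRank r) → ∀ i, InAcl (x i)

def SplitAtTwo : Prop :=
  FreeSparsityTwo → MultDegenerateCounterexampleInAcl → MinimalCounterexampleInAclTwo

/-- Sanity: the `n = 2` slice is literally an instance of the crux. -/
theorem two_slice_of_crux
    (h : Summit.Schanuel.Schanuel.Theses.RigidCore.MinimalCounterexampleInAcl) :
    MinimalCounterexampleInAclTwo :=
  fun x hx ht hr i => h 2 x hx ht hr i

end Summit.Schanuel.Schanuel.Cruxes.MinimalCounterexampleInAcl.Sketch

end
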